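import Literature.NumberTheory.GaloisRepresentations.CubicEisensteinRamificationProofs
import Literature.NumberTheory.GaloisRepresentations.TameInertiaProofs
import HarnessLib

/-!
# Ramification of the splitting field of an Eisenstein cubic, II: the groups `G_i`, `i ≥ 1`, and
# the case `e = 3` (Serre, *Local Fields*, Ch. IV §§1–2; Silverman *ATAEC* IV.11.1, `p = 3`)

`Proofs` file (theorems only, no definitions, no named facts) in topic
`NumberTheory/GaloisRepresentations`, continuing `CubicEisensteinRamificationProofs` (same seat,
bsd.S15; same setting: `R` Dedekind with fraction field `K`, `L/K` finite Galois with group `G`,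
`S = integralClosure R L`, `𝔓 ≠ 0` maximal in `S`, `𝔭 = 𝔓 ∩ R`, three distinct roots
`θ₁, θ₂, θ₃ ∈ S` of `X³ + c₂X² + c₁X + c₀`, `cᵢ ∈ R`, Eisenstein at `𝔭`, permuted faithfully by
`G`; now in **residue characteristic `3`**: `3 ∈ 𝔓`).

* `isPGroup_three_ramificationSubgroup_one`, `orderOf_eq_three_of_mem_ramificationSubgroup` —
  `G_1` is a `3`-group (Serre IV §2 Cor. 3, the tree's `Ideal.isPGroup_ramificationSubgroup_one`),
  so a non-trivial element of `G_i`, `i ≥ 1`, has order `3` (`#G ∣ 6`);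
* `ramificationSubgroup_ne_bot_iff_mem`, `card_ramificationSubgroup_eq_three` — for `i ≥ 1`,
  **`G_i ≠ 1 ↔ τ ∈ G_i`** and then **`#G_i = 3`**, where `τ` is a `3`-cycle of the roots in `G`
  (a non-trivial element of `G_i` is a `3`-cycle, hence `τ` or `τ²`);
* `mem_ramificationSubgroup_iff_of_mem_inertia` — the uniformizer criterion
  `τ ∈ G_i ↔ τϖ - ϖ ∈ 𝔓ⁱ⁺¹` for `τ ∈ G₀` and `ϖ ∈ 𝔓 ∖ 𝔓²`
  (`mem_ramificationSubgroup_iff_smul_sub_mem_pow` with the inertia-invariant residue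
  representatives of `exists_inertia_fixed_sub_mem`, Serre I §7 Prop. 21 c));
* `discr_mem_pow_three` — `disc ∈ 𝔭³` (because `3 ∈ 𝔭`);
* `mem_ramificationSubgroup_iff_of_ord_eq_one`, `exists_break_of_card_inertia_eq_three` — **the
  case `e = 3`** (`v_𝔓(θ₁) = 1`, so `ϖ = θ₁` is a uniformizer and `τϖ - ϖ = θ₂ - θ₁`): there is
  `b ≥ 1` (`= t - 1`, `t = v_𝔓(θ₁ - θ₂)`, `v_𝔭(disc) = 2t ≥ 3`) with `G_i ≠ 1 ↔ i ≤ b` for `i ≥ 1`,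
  `#G_i = 3` for `1 ≤ i ≤ b`, and **`6b = #G₀ · (v_𝔭(disc) - 2)`**.

This is the computation *"`r = v_L(π_L^σ - π_L)` … `3r = v_L(Disc(f)) - 3` … `E[2]^{G_i}` is
trivial for `i < r`"* of Silverman's proof of Ogg's formula for `p = 3` (*ATAEC* PDF p. 370) in
the case where a root is already a uniformizer; the totally ramified case `e = 6` (where the
uniformizer has to be manufactured from `∏(θᵢ - θⱼ)`, `θ₁` and a uniformizer of `𝔭`, and
`v_𝔭(disc)` is odd) is the object of the sequel, with the same conclusion
`6b = #G₀ · (v_𝔭(disc) - 2)`.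

No definitions, no named facts.  All axioms `propext`, `Classical.choice`, `Quot.sound`.

## References

* J.-P. Serre, *Local Fields*, GTM 67 (1979): Ch. I §7 Prop. 21; Ch. IV §1 Lemma 1, Prop. 2,
  §2 Prop. 5 and Cor. 3 of Prop. 7. [SerreLocalFields1979]
* J. H. Silverman, *Advanced Topics in the Arithmetic of Elliptic Curves*, GTM 151 (1994), proof of
  Thm. IV.11.1 for `p = 3` (PDF pp. 369–370). [SilvermanATAEC1994]
-/

noncomputable section

open scoped Pointwise

namespace Literature.NumberTheory.GaloisRepresentations

variable (R : Type*) {K L : Type*} [CommRing R] [IsDedekindDomain R] [Field K] [Field L]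
  [Algebra R K] [IsFractionRing R K] [Algebra R L] [Algebra K L] [IsScalarTower R K L]
  [FiniteDimensional K L] [IsGalois K L]
  (𝔓 : Ideal (integralClosure R L)) [𝔓.IsMaximal]

variable {R}

/-! ### The ramification groups `G_i`, `i ≥ 1`, are `1` or `⟨τ⟩` -/

include K in
/-- `G_1` is a `3`-group when `3 ∈ 𝔓` (Serre IV §2 Cor. 3; the tree's
`Ideal.isPGroup_ramificationSubgroup_one` for `Gal(L/K)` acting on `S`). [cite: SerreLocalFields1979, Ch. IV §2 Cor. 3 of Prop. 7] -/
theorem isPGroup_three_ramificationSubgroup_one (h3 : (3 : integralClosure R L) ∈ 𝔓) :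
    IsPGroup 3 (𝔓.ramificationSubgroup (L ≃ₐ[K] L) 1) := by
  haveI := faithfulSMul_algEquiv_integralClosure R (K := K) (L := L)
  haveI : IsNoetherianRing (integralClosure R L) :=
    IsIntegralClosure.isNoetherianRing R K L (integralClosure R L)
  exact Ideal.isPGroup_ramificationSubgroup_one 𝔓 (L ≃ₐ[K] L) Ideal.IsPrime.ne_top'
    (by exact_mod_cast h3)

include K in
/-- For `i ≥ 1`, a non-trivial element of `G_i` has order `3`, provided `3 ∈ 𝔓` and `#G ∣ 6`
(`G_i ≤ G_1` is a `3`-group of order dividing `6`). [folklore] -/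
theorem orderOf_eq_three_of_mem_ramificationSubgroup (h3 : (3 : integralClosure R L) ∈ 𝔓)
    (h6 : Nat.card (L ≃ₐ[K] L) ∣ 6) {i : ℕ} (hi : 1 ≤ i) {g : L ≃ₐ[K] L}
    (hg : g ∈ 𝔓.ramificationSubgroup (L ≃ₐ[K] L) i) (hg1 : g ≠ 1) : orderOf g = 3 := by
  have hg' : g ∈ 𝔓.ramificationSubgroup (L ≃ₐ[K] L) 1 :=
    Ideal.ramificationSubgroup_antitone 𝔓 (L ≃ₐ[K] L) hi hg
  obtain ⟨k, hk⟩ := isPGroup_three_ramificationSubgroup_one (K := K) 𝔓 h3 ⟨g, hg'⟩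
  have hgk : g ^ 3 ^ k = 1 := by simpa using congrArg Subtype.val hk
  have hdvd : orderOf g ∣ 3 ^ k := orderOf_dvd_of_pow_eq_one hgk
  obtain ⟨j, -, hj⟩ := (Nat.dvd_prime_pow Nat.prime_three).mp hdvd
  have h6' : 3 ^ j ∣ 6 := hj ▸ (orderOf_dvd_natCard g).trans h6
  have hj1 : j ≤ 1 := by
    by_contra h
    push Not at h
    have : 3 ^ 2 ∣ 6 := (pow_dvd_pow 3 h).trans h6'
    norm_num at this
  interval_cases j
  · rw [pow_zero] at hj
    exact absurd (orderOf_eq_one_iff.mp hj) hg1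
  · rw [hj, pow_one]

/-- For `i ≥ 1`, **`G_i ≠ 1` iff `τ ∈ G_i`**, where `τ ∈ G` is a `3`-cycle on the roots
(`τθ₁ = θ₂, τθ₂ = θ₃, τθ₃ = θ₁`) and `G` acts faithfully on the three distinct roots: a
non-trivial `g ∈ G_i` has order `3` (`orderOf_eq_three_of_mem_ramificationSubgroup`), so it is a
`3`-cycle (`smul_ne_self_of_orderOf_eq_three`), hence `g = τ` or `g = τ²` on the roots, i.e. in
`G`. [folklore] -/
theorem ramificationSubgroup_ne_bot_iff_mem (h3 : (3 : integralClosure R L) ∈ 𝔓)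
    {θ₁ θ₂ θ₃ : integralClosure R L} {c₂ c₁ c₀ : R}
    (hV₁ : θ₁ + θ₂ + θ₃ = -algebraMap R _ c₂) (hV₂ : θ₁ * θ₂ + θ₁ * θ₃ + θ₂ * θ₃ = algebraMap R _ c₁)
    (hV₃ : θ₁ * θ₂ * θ₃ = -algebraMap R _ c₀)
    (h12 : θ₁ ≠ θ₂) (h13 : θ₁ ≠ θ₃) (h23 : θ₂ ≠ θ₃)
    (hfaith : ∀ g : L ≃ₐ[K] L, g • θ₁ = θ₁ → g • θ₂ = θ₂ → g • θ₃ = θ₃ → g = 1)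
    {τ : L ≃ₐ[K] L} (hτ1 : τ • θ₁ = θ₂) (hτ2 : τ • θ₂ = θ₃) (hτ3 : τ • θ₃ = θ₁)
    {i : ℕ} (hi : 1 ≤ i) :
    𝔓.ramificationSubgroup (L ≃ₐ[K] L) i ≠ ⊥ ↔ τ ∈ 𝔓.ramificationSubgroup (L ≃ₐ[K] L) i := by
  have h6 : Nat.card (L ≃ₐ[K] L) ∣ 6 := card_dvd_six (K := K) hV₁ hV₂ hV₃ h12 h13 h23 hfaith
  have hτne : τ ≠ 1 := fun h ↦ h12 (by rw [← hτ1, h, one_smul])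
  refine ⟨fun hne ↦ ?_, fun hτ ↦ fun hbot ↦ hτne (Subgroup.mem_bot.mp (hbot ▸ hτ))⟩
  obtain ⟨g, hg1⟩ := (Subgroup.ne_bot_iff_exists_ne_one).mp hne
  have hg1' : (g : L ≃ₐ[K] L) ≠ 1 := fun h ↦ hg1 (Subtype.ext h)
  have hord := orderOf_eq_three_of_mem_ramificationSubgroup (K := K) 𝔓 h3 h6 hi g.2 hg1'
  set γ : L ≃ₐ[K] L := (g : L ≃ₐ[K] L) with hγ
  have hord2 : orderOf (γ ^ 2) = 3 := by
    rw [orderOf_pow' γ two_ne_zero, hord]; rfl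
  -- `γ` moves `θ₁`; so `γθ₁ = θ₂` or `γθ₁ = θ₃`
  have hmv := smul_ne_self_of_orderOf_eq_three (K := K) hV₁ hV₂ hV₃ h12 h13 h23 hfaith hord
  have hmv2 := smul_ne_self_of_orderOf_eq_three (K := K) hV₁ hV₂ hV₃ h12 h13 h23 hfaith hord2
  -- compare with `τ`: `τ⁻¹ γ` or `τ⁻¹ γ²`... we show `γ = τ` or `γ² = τ`
  have key : ∀ {δ : L ≃ₐ[K] L}, orderOf δ = 3 → orderOf (δ ^ 2) = 3 → δ • θ₁ = θ₂ → δ = τ := by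
    intro δ hδ hδ2 hδ1
    have hm1 := smul_ne_self_of_orderOf_eq_three (K := K) hV₁ hV₂ hV₃ h12 h13 h23 hfaith hδ2
    -- `δθ₂ = θ₃`: otherwise `δθ₂ = θ₁` and `δ²` fixes `θ₁`
    have hδ2' : δ • θ₂ = θ₃ := by
      rcases smul_mem_roots (K := K) hV₁ hV₂ hV₃ δ (Or.inr (Or.inl rfl)) with h | h | h
      · exact absurd (show δ ^ 2 • θ₁ = θ₁ by rw [pow_two, mul_smul, hδ1, h]) hm1
      · exact absurd (smul_left_cancel δ (hδ1.trans h.symm)) h12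
      · exact h
    have hδ3' : δ • θ₃ = θ₁ := by
      rcases smul_mem_roots (K := K) hV₁ hV₂ hV₃ δ (Or.inr (Or.inr rfl)) with h | h | h
      · exact h
      · exact absurd (smul_left_cancel δ (hδ1.trans h.symm)) h13
      · exact absurd (smul_left_cancel δ (hδ2'.trans h.symm)) h23
    have h := hfaith (τ⁻¹ * δ) (by rw [mul_smul, hδ1, ← hτ1, inv_smul_smul])
      (by rw [mul_smul, hδ2', ← hτ2, inv_smul_smul]) (by rw [mul_smul, hδ3', ← hτ3, inv_smul_smul])
    rwa [inv_mul_eq_one, eq_comm] at h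
  rcases smul_mem_roots (K := K) hV₁ hV₂ hV₃ γ (Or.inl rfl) with h1 | h1 | h1
  · exact absurd h1 hmv
  · -- `γθ₁ = θ₂`: `γ = τ`
    have hord4 : orderOf ((γ ^ 2) ^ 2) = 3 := by
      rw [orderOf_pow' _ two_ne_zero, hord2]; rfl
    rw [← key hord hord2 h1]
    exact g.2
  · -- `γθ₁ = θ₃`: then `γ²θ₁ = θ₂` and `γ² = τ`
    have hγ3 : γ • θ₃ = θ₂ := by
      rcases smul_mem_roots (K := K) hV₁ hV₂ hV₃ γ (Or.inr (Or.inr rfl)) with h | h | h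
      · exact absurd (show γ ^ 2 • θ₁ = θ₁ by rw [pow_two, mul_smul, h1, h]) hmv2
      · exact h
      · exact absurd (smul_left_cancel γ (h1.trans h.symm)) h13
    have h21 : γ ^ 2 • θ₁ = θ₂ := by rw [pow_two, mul_smul, h1, hγ3]
    have hord4 : orderOf ((γ ^ 2) ^ 2) = 3 := by
      rw [orderOf_pow' _ two_ne_zero, hord2]; rfl
    rw [← key hord2 hord4 h21]
    exact Subgroup.pow_mem _ g.2 2

/-- For `i ≥ 1` with `τ ∈ G_i` (`τ` a `3`-cycle as above), **`#G_i = 3`**: `G_i ≤ G_1` is a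
`3`-group of order dividing `#G ∣ 6`, and non-trivial. [folklore] -/
theorem card_ramificationSubgroup_eq_three (h3 : (3 : integralClosure R L) ∈ 𝔓)
    (h6 : Nat.card (L ≃ₐ[K] L) ∣ 6) {τ : L ≃ₐ[K] L} (hτ : orderOf τ = 3)
    {i : ℕ} (hi : 1 ≤ i) (hτi : τ ∈ 𝔓.ramificationSubgroup (L ≃ₐ[K] L) i) :
    Nat.card (𝔓.ramificationSubgroup (L ≃ₐ[K] L) i) = 3 := by
  haveI : Fact (Nat.Prime 3) := ⟨Nat.prime_three⟩
  have hP : IsPGroup 3 (𝔓.ramificationSubgroup (L ≃ₐ[K] L) i) :=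
    (isPGroup_three_ramificationSubgroup_one (K := K) 𝔓 h3).to_le
      (Ideal.ramificationSubgroup_antitone 𝔓 (L ≃ₐ[K] L) hi)
  obtain ⟨k, hk⟩ := hP.exists_card_eq
  have hdvd : 3 ^ k ∣ 6 := hk ▸ (Subgroup.card_subgroup_dvd_card _).trans h6
  have h3dvd : 3 ∣ Nat.card (𝔓.ramificationSubgroup (L ≃ₐ[K] L) i) := by
    rw [← hτ, ← Subgroup.orderOf_mk τ hτi]
    exact orderOf_dvd_natCard _
  rw [hk] at h3dvd ⊢
  have hk1 : k ≤ 1 := by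
    by_contra h
    push Not at h
    have : 3 ^ 2 ∣ 6 := (pow_dvd_pow 3 h).trans hdvd
    norm_num at this
  interval_cases k
  · norm_num at h3dvd
  · rfl


/-! ### The uniformizer criterion for `τ ∈ G₀` -/

include K in
/-- **Uniformizer criterion** for an element `τ` of the inertia group: `τ ∈ G_i ↔ τϖ - ϖ ∈ 𝔓ⁱ⁺¹`
for any `ϖ ∈ 𝔓 ∖ 𝔓²` (`mem_ramificationSubgroup_iff_smul_sub_mem_pow`; the residue classes are
represented by inertia invariants, `exists_inertia_fixed_sub_mem`, Serre I §7 Prop. 21 c)).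
[cite: SerreLocalFields1979, Ch. IV §1 Lemma 1 and §2 Prop. 5] -/
theorem mem_ramificationSubgroup_iff_of_mem_inertia
    [Algebra.IsSeparable (R ⧸ 𝔓.under R) (integralClosure R L ⧸ 𝔓)] (h𝔓 : 𝔓 ≠ ⊥)
    {τ : L ≃ₐ[K] L} (hτ : τ ∈ 𝔓.inertia (L ≃ₐ[K] L))
    {ϖ : integralClosure R L} (hϖ : ϖ ∈ 𝔓) (hϖ2 : ϖ ∉ 𝔓 ^ 2) (i : ℕ) :
    τ ∈ 𝔓.ramificationSubgroup (L ≃ₐ[K] L) i ↔ τ • ϖ - ϖ ∈ 𝔓 ^ (i + 1) := by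
  haveI : IsDedekindDomain (integralClosure R L) := integralClosure.isDedekindDomain R K L
  haveI : 𝔓.LiesOver (𝔓.under R) := ⟨rfl⟩
  haveI : (𝔓.under R).IsMaximal := Ideal.IsMaximal.under R 𝔓
  have hτ𝔓 : τ • 𝔓 = 𝔓 := 𝔓.inertia_le_stabilizer hτ
  refine mem_ramificationSubgroup_iff_smul_sub_mem_pow 𝔓 h𝔓 hτ𝔓 (fun b ↦ ?_) hϖ hϖ2 i
  obtain ⟨b₀, hb₀, hb⟩ := exists_inertia_fixed_sub_mem (L ≃ₐ[K] L) (𝔓.under R) 𝔓 b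
  exact ⟨b₀, hb₀ τ hτ, hb⟩

/-! ### The discriminant lies in `𝔭³` -/

omit [IsDedekindDomain R] [IsFractionRing R K] [FiniteDimensional K L] [IsGalois K L]
  [𝔓.IsMaximal] in
/-- In residue characteristic `3` the discriminant of an Eisenstein cubic lies in `𝔭³`:
`c₂²c₁², 4c₁³, 4c₂³c₀ ∈ 𝔭³` from `cᵢ ∈ 𝔭`, and `27c₀², 18c₂c₁c₀ ∈ 𝔭³` because `3 ∈ 𝔭`.
[folklore] -/
theorem discr_mem_pow_three {p : Ideal R} {c₂ c₁ c₀ : R}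
    (hc₂ : c₂ ∈ p) (hc₁ : c₁ ∈ p) (hc₀ : c₀ ∈ p) (h3 : (3 : R) ∈ p) :
    c₂ ^ 2 * c₁ ^ 2 - 4 * c₁ ^ 3 - 4 * c₂ ^ 3 * c₀ - 27 * c₀ ^ 2 + 18 * c₂ * c₁ * c₀ ∈ p ^ 3 := by
  have hp3 : ∀ {x y z : R}, x ∈ p → y ∈ p → z ∈ p → x * y * z ∈ p ^ 3 := by
    intro x y z hx hy hz
    rw [pow_succ, pow_two]
    exact Ideal.mul_mem_mul (Ideal.mul_mem_mul hx hy) hz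
  have t1 : c₂ ^ 2 * c₁ ^ 2 ∈ p ^ 3 := by
    have := hp3 hc₂ hc₁ hc₁
    have e : c₂ ^ 2 * c₁ ^ 2 = c₂ * (c₂ * c₁ * c₁) := by ring
    rw [e]; exact Ideal.mul_mem_left _ _ this
  have t2 : 4 * c₁ ^ 3 ∈ p ^ 3 := by
    have e : 4 * c₁ ^ 3 = 4 * (c₁ * c₁ * c₁) := by ring
    rw [e]; exact Ideal.mul_mem_left _ _ (hp3 hc₁ hc₁ hc₁)
  have t3 : 4 * c₂ ^ 3 * c₀ ∈ p ^ 3 := by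
    have e : 4 * c₂ ^ 3 * c₀ = 4 * c₀ * (c₂ * c₂ * c₂) := by ring
    rw [e]; exact Ideal.mul_mem_left _ _ (hp3 hc₂ hc₂ hc₂)
  have t4 : 27 * c₀ ^ 2 ∈ p ^ 3 := by
    have e : (27 : R) * c₀ ^ 2 = 9 * (3 * c₀ * c₀) := by ring
    rw [e]; exact Ideal.mul_mem_left _ _ (hp3 h3 hc₀ hc₀)
  have t5 : 18 * c₂ * c₁ * c₀ ∈ p ^ 3 := by
    have e : (18 : R) * c₂ * c₁ * c₀ = 6 * c₀ * (3 * c₂ * c₁) := by ring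
    rw [e]; exact Ideal.mul_mem_left _ _ (hp3 h3 hc₂ hc₁)
  exact Ideal.add_mem _ (Ideal.sub_mem _ (Ideal.sub_mem _ (Ideal.sub_mem _ t1 t2) t3) t4) t5

/-! ### The case `e = 3`: `ϖ = θ₁` -/

include K in
/-- **The filtration when `e = 3`.**  In the setting of `card_inertia_eq_three_or_six` with
`#G₀ = 3` and `v_𝔓(θ₁) = 1`, the `3`-cycle `τ` (`τθ₁ = θ₂`) satisfies, for every `i`:
`τ ∈ G_i ↔ i + 1 ≤ t` with `t = v_𝔓(θ₁ - θ₂)` — the uniformizer criterion with `ϖ = θ₁`,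
`τϖ - ϖ = θ₂ - θ₁` (Silverman *ATAEC* p. 370: *"`r = v_L(π_L^σ - π_L)`"*).
[cite: SilvermanATAEC1994, proof of Thm. IV.11.1 for p = 3 (PDF p. 370)]
[cite: SerreLocalFields1979, Ch. IV §1 Lemma 1] -/
theorem mem_ramificationSubgroup_iff_of_ord_eq_one
    [Algebra.IsSeparable (R ⧸ 𝔓.under R) (integralClosure R L ⧸ 𝔓)] (h𝔓 : 𝔓 ≠ ⊥)
    {θ₁ θ₂ : integralClosure R L} {τ : L ≃ₐ[K] L} (hτ : τ ∈ 𝔓.inertia (L ≃ₐ[K] L))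
    (hτ1 : τ • θ₁ = θ₂) (hord : ord 𝔓 θ₁ = 1) (i : ℕ) :
    τ ∈ 𝔓.ramificationSubgroup (L ≃ₐ[K] L) i ↔ ((i + 1 : ℕ) : ℕ∞) ≤ ord 𝔓 (θ₁ - θ₂) := by
  haveI : IsDedekindDomain (integralClosure R L) := integralClosure.isDedekindDomain R K L
  have hϖ : θ₁ ∈ 𝔓 := by
    have := (mem_pow_iff_le_ord 𝔓 (b := θ₁) (n := 1)).mpr (by rw [hord]; exact_mod_cast le_rfl)
    rwa [pow_one] at this
  have hϖ2 : θ₁ ∉ 𝔓 ^ 2 := fun h ↦ by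
    have := (mem_pow_iff_le_ord 𝔓).mp h
    rw [hord] at this
    exact absurd (by exact_mod_cast this : (2 : ℕ) ≤ 1) (by norm_num)
  rw [mem_ramificationSubgroup_iff_of_mem_inertia (K := K) 𝔓 h𝔓 hτ hϖ hϖ2 i, hτ1,
    mem_pow_iff_le_ord, ← ord_neg 𝔓 (θ₂ - θ₁), neg_sub]

include K in
/-- **The lower ramification filtration of the splitting field of an Eisenstein cubic in residue
characteristic `3`, case `e = 3`.**  Setting: `R` Dedekind with fraction field `K`, `L/K` finite
Galois with group `G`, `S = integralClosure R L`, `𝔓 ≠ 0` maximal in `S` with separable residue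
extension, `3 ∈ 𝔓`; `θ₁, θ₂, θ₃ ∈ S` distinct with `∏(X - θᵢ) = X³ + c₂X² + c₁X + c₀`,
`cᵢ ∈ R`, Eisenstein at `𝔭 = 𝔓 ∩ R`, on which `G` acts faithfully; `#G₀ = 3`.  Then there is
`b ≥ 1` such that for `i ≥ 1`: `G_i ≠ 1 ↔ i ≤ b`, `#G_i = 3` for `1 ≤ i ≤ b`, and
**`6b = #G₀ · (v_𝔭(disc) - 2)`** with `disc = c₂²c₁² - 4c₁³ - 4c₂³c₀ - 27c₀² + 18c₂c₁c₀`
(here `v_𝔭(disc) = 2t`, `b = t - 1`, `t = v_𝔓(θ₁ - θ₂)`).  This is the computation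
`r = v_L(π_L^σ - π_L)`, `3r = v_L(Disc f) - 3` of Silverman's proof of Ogg's formula for `p = 3`
(*ATAEC* PDF p. 370) in the case where a root is a uniformizer.
[cite: SilvermanATAEC1994, proof of Thm. IV.11.1 for p = 3 (PDF pp. 369–370)]
[cite: SerreLocalFields1979, Ch. IV §1 Lemma 1, Prop. 2] -/
theorem exists_break_of_card_inertia_eq_three
    [Algebra.IsSeparable (R ⧸ 𝔓.under R) (integralClosure R L ⧸ 𝔓)] (h𝔓 : 𝔓 ≠ ⊥)
    (h3 : (3 : R) ∈ 𝔓.under R)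
    {θ₁ θ₂ θ₃ : integralClosure R L} {c₂ c₁ c₀ : R}
    (hV₁ : θ₁ + θ₂ + θ₃ = -algebraMap R _ c₂) (hV₂ : θ₁ * θ₂ + θ₁ * θ₃ + θ₂ * θ₃ = algebraMap R _ c₁)
    (hV₃ : θ₁ * θ₂ * θ₃ = -algebraMap R _ c₀)
    (hc₂ : c₂ ∈ 𝔓.under R) (hc₁ : c₁ ∈ 𝔓.under R) (hc₀ : c₀ ∈ 𝔓.under R)
    (hc₀' : c₀ ∉ (𝔓.under R) ^ 2)
    (h12 : θ₁ ≠ θ₂) (h13 : θ₁ ≠ θ₃) (h23 : θ₂ ≠ θ₃)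
    (hfaith : ∀ g : L ≃ₐ[K] L, g • θ₁ = θ₁ → g • θ₂ = θ₂ → g • θ₃ = θ₃ → g = 1)
    (hcard : Nat.card (𝔓.inertia (L ≃ₐ[K] L)) = 3) :
    ∃ b n : ℕ, 1 ≤ b ∧
      (∀ i, 1 ≤ i → (𝔓.ramificationSubgroup (L ≃ₐ[K] L) i ≠ ⊥ ↔ i ≤ b)) ∧
      (∀ i, 1 ≤ i → i ≤ b → Nat.card (𝔓.ramificationSubgroup (L ≃ₐ[K] L) i) = 3) ∧
      ord (𝔓.under R) (c₂ ^ 2 * c₁ ^ 2 - 4 * c₁ ^ 3 - 4 * c₂ ^ 3 * c₀ - 27 * c₀ ^ 2 +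
        18 * c₂ * c₁ * c₀) = n ∧
      6 * b = Nat.card (𝔓.inertia (L ≃ₐ[K] L)) * (n - 2) ∧ 3 ≤ n := by
  haveI : IsDedekindDomain (integralClosure R L) := integralClosure.isDedekindDomain R K L
  have h3S : (3 : integralClosure R L) ∈ 𝔓 := by
    have := Ideal.mem_comap.mp h3
    rwa [map_ofNat] at this
  have h6 : Nat.card (L ≃ₐ[K] L) ∣ 6 := card_dvd_six (K := K) hV₁ hV₂ hV₃ h12 h13 h23 hfaith
  -- `v(θ₁) = 1`
  have hordθ : ord 𝔓 θ₁ = 1 := by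
    rcases card_inertia_eq_three_or_six (K := K) 𝔓 h𝔓 hV₁ hV₂ hV₃ hc₂ hc₁ hc₀ hc₀' h12 h13 h23
      hfaith with ⟨-, h⟩ | ⟨h, -⟩
    · exact h
    · rw [hcard] at h; exact absurd h (by norm_num)
  -- the `3`-cycle `τ ∈ G₀`; arrange `τθ₁ = θ₂` by renaming `θ₂ ↔ θ₃` if necessary
  obtain ⟨τ, hτI, hτord, hcyc⟩ := exists_three_cycle_mem_inertia (K := K) 𝔓 hV₁ hV₂ hV₃ h12 h13 h23
    hfaith (by rw [hcard])
  have hτ𝔓 : τ • 𝔓 = 𝔓 := 𝔓.inertia_le_stabilizer hτI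
  -- `n`, `t` and the relation `3 n = 6 t`
  have hp : 𝔓.under R ≠ ⊥ := Ideal.IsIntegral.comap_ne_bot _ h𝔓
  set disc := c₂ ^ 2 * c₁ ^ 2 - 4 * c₁ ^ 3 - 4 * c₂ ^ 3 * c₀ - 27 * c₀ ^ 2 + 18 * c₂ * c₁ * c₀
    with hdisc
  have hn3 : ((3 : ℕ) : ℕ∞) ≤ ord (𝔓.under R) disc :=
    (mem_pow_iff_le_ord _).mp (discr_mem_pow_three hc₂ hc₁ hc₀ h3)
  have he3 : (𝔓.under R).ramificationIdx' 𝔓 = 3 := by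
    rw [ramificationIdx'_under_base_eq_card_inertia (K := K) 𝔓 h𝔓, hcard]
  rcases hcyc with ⟨h1, h2, h3'⟩ | ⟨h1, h3', h2⟩
  · -- `τ : θ₁ ↦ θ₂ ↦ θ₃ ↦ θ₁`
    have hrel := ramificationIdx'_mul_ord_discr_eq (K := K) 𝔓 h𝔓 hV₁ hV₂ hV₃ hτ𝔓 h1 h2 h3'
    rw [he3] at hrel
    obtain ⟨t, ht⟩ := exists_ord_eq_natCast 𝔓 h𝔓 (sub_ne_zero.mpr h12)
    rw [ht, ← hdisc] at hrel
    -- `n = 2t`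
    have hdisc0 : disc ≠ 0 := by
      rintro h0
      rw [h0, ord_zero, ENat.mul_top (by norm_num)] at hrel
      exact absurd hrel.symm (by exact_mod_cast ENat.coe_ne_top (6 * t))
    obtain ⟨n, hn⟩ := exists_ord_eq_natCast (𝔓.under R) hp hdisc0
    rw [hn] at hrel hn3
    have hnt : 3 * n = 6 * t := by exact_mod_cast hrel
    have hn3' : 3 ≤ n := by exact_mod_cast hn3
    have ht2 : 2 ≤ t := by omega
    refine ⟨t - 1, n, by omega, fun i hi ↦ ?_, fun i hi hib ↦ ?_, hn, by rw [hcard]; omega, hn3'⟩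
    · rw [ramificationSubgroup_ne_bot_iff_mem (K := K) 𝔓 h3S hV₁ hV₂ hV₃ h12 h13 h23 hfaith h1 h2 h3' hi,
        mem_ramificationSubgroup_iff_of_ord_eq_one (K := K) 𝔓 h𝔓 hτI h1 hordθ i, ht]
      constructor
      · intro h; have : i + 1 ≤ t := by exact_mod_cast h
        omega
      · intro h; exact_mod_cast (by omega : i + 1 ≤ t)
    · refine card_ramificationSubgroup_eq_three (K := K) 𝔓 h3S h6 hτord hi ?_
      rw [mem_ramificationSubgroup_iff_of_ord_eq_one (K := K) 𝔓 h𝔓 hτI h1 hordθ i, ht]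
      exact_mod_cast (by omega : i + 1 ≤ t)
  · -- `τ : θ₁ ↦ θ₃ ↦ θ₂ ↦ θ₁`: the same with `θ₂ ↔ θ₃`
    have hrel := ramificationIdx'_mul_ord_discr_eq (K := K) 𝔓 h𝔓 (θ₁ := θ₁) (θ₂ := θ₃) (θ₃ := θ₂)
      (c₂ := c₂) (c₁ := c₁) (c₀ := c₀) (by rw [← hV₁]; ring) (by rw [← hV₂]; ring)
      (by rw [← hV₃]; ring) hτ𝔓 h1 h3' h2
    rw [he3] at hrel
    obtain ⟨t, ht⟩ := exists_ord_eq_natCast 𝔓 h𝔓 (sub_ne_zero.mpr h13)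
    rw [ht, ← hdisc] at hrel
    have hdisc0 : disc ≠ 0 := by
      rintro h0
      rw [h0, ord_zero, ENat.mul_top (by norm_num)] at hrel
      exact absurd hrel.symm (by exact_mod_cast ENat.coe_ne_top (6 * t))
    obtain ⟨n, hn⟩ := exists_ord_eq_natCast (𝔓.under R) hp hdisc0
    rw [hn] at hrel hn3
    have hnt : 3 * n = 6 * t := by exact_mod_cast hrel
    have hn3' : 3 ≤ n := by exact_mod_cast hn3
    have ht2 : 2 ≤ t := by omega
    have hfaith' : ∀ g : L ≃ₐ[K] L, g • θ₁ = θ₁ → g • θ₃ = θ₃ → g • θ₂ = θ₂ → g = 1 :=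
      fun g g1 g3 g2 ↦ hfaith g g1 g2 g3
    refine ⟨t - 1, n, by omega, fun i hi ↦ ?_, fun i hi hib ↦ ?_, hn, by rw [hcard]; omega, hn3'⟩
    · rw [ramificationSubgroup_ne_bot_iff_mem (K := K) 𝔓 h3S (θ₁ := θ₁) (θ₂ := θ₃) (θ₃ := θ₂)
        (c₂ := c₂) (c₁ := c₁) (c₀ := c₀) (by rw [← hV₁]; ring) (by rw [← hV₂]; ring)
        (by rw [← hV₃]; ring) h13 h12 (Ne.symm h23) hfaith' h1 h3' h2 hi,
        mem_ramificationSubgroup_iff_of_ord_eq_one (K := K) 𝔓 h𝔓 hτI h1 hordθ i, ht]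
      constructor
      · intro h; have : i + 1 ≤ t := by exact_mod_cast h
        omega
      · intro h; exact_mod_cast (by omega : i + 1 ≤ t)
    · refine card_ramificationSubgroup_eq_three (K := K) 𝔓 h3S h6 hτord hi ?_
      rw [mem_ramificationSubgroup_iff_of_ord_eq_one (K := K) 𝔓 h𝔓 hτI h1 hordθ i, ht]
      exact_mod_cast (by omega : i + 1 ≤ t)

end Literature.NumberTheory.GaloisRepresentations

end
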